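import Summits.AtomisticToContinuum.FouriersLaw.Theorems.BondHeatUncertaintyLinearResponseFTURBondHeatVarianceContinuityHelper1

/-!
# Helper 2 for stub `stub_bondHeatVarianceContinuity` (crux ★ `LinearResponseFTUR`, stmt-AtomisticToContinuum-9122):
# CEHR Theorem 5.1 with an energy threshold UNIFORM on a temperature box

Support file for line `lebesgue-flip-duality`, stub K6b. For the pinned chain (all parameters `> 0`,
`N ≥ 2`), a temperature ceiling `T_m > 0`, `0 < θ < 1/T_m` and `t* > 0`, there is ONE threshold `E₀` such
that for ALL bath temperatures `0 < T_L, T_R ≤ T_m` and all starts with `H(x) ≥ E₀`,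
`E_x e^{θH(z_{t*})} ≤ ½ e^{θH(x)}` (`uniformH2_small`). Proof: the bookkeeping (Steps 1 and 6) of the tree
proof of `pinnedChain_lintegral_exp_hamiltonian_small` run with the box constants
`κ = θ(1 - θT_m)`, `C = 2θγT_m`, `p = (1 + 1/(θT_m))/2`, `c_max = √(2γT_m)`, which dominate the true
constants monotonically, around the probabilistic core `uniformH2_core` (Helper 1). Nothing here closes an
item.
-/

noncomputable section

namespace Summit.AtomisticToContinuum.FouriersLaw.Theorems.LinearResponseFTUR

open MeasureTheory ProbabilityTheory Filter Topology Set Metric Finset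
open scoped NNReal ENNReal Topology
open Literature.MathematicalPhysics.KineticTheory.HeatConduction Literature.Probability.Process OscillatorChain

-- the flow is a limit of Picard iterations: never let the unifier unfold it (heartbeats)
attribute [local irreducible] OscillatorChain.chainFlow

/-- **CEHR Theorem 5.1 with a threshold uniform on the temperature box** (pinned chain, `ω₂, lam, β, γ > 0`,
`N ≥ 2`): for `T_m > 0`, `0 < θ < 1/T_m`, `t* > 0` there is `E₀` such that for all `0 < T_L, T_R ≤ T_m` and
all `x` with `H(x) ≥ E₀`, `E_x e^{θH(z_{t*})} ≤ ½ e^{θH(x)}`. [cite: CuneoEckmannHairerReyBellet2018, Thm 5.1] -/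
theorem uniformH2_small :
    ∀ ω₂ lam β γ : ℝ, 0 < ω₂ → 0 < lam → 0 < β → 0 < γ → ∀ (N : ℕ), 1 < N →
    ∀ (Tm θ tstar : ℝ), 0 < Tm → 0 < θ → θ < 1 / Tm → 0 < tstar →
    ∃ E₀ : ℝ, ∀ (T_L T_R : ℝ), 0 < T_L → 0 < T_R → T_L ≤ Tm → T_R ≤ Tm →
      ∀ x : PhaseSpace N, E₀ ≤ (pinnedChain ω₂ lam β γ).hamiltonian N x →
        ∫⁻ ω, ENNReal.ofReal (Real.exp (θ * (pinnedChain ω₂ lam β γ).hamiltonian N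
            ((pinnedChain ω₂ lam β γ).solMap N T_L T_R tstar x (pairPath ω)))) ∂wienerPair ≤
          ENNReal.ofReal (Real.exp (θ * (pinnedChain ω₂ lam β γ).hamiltonian N x) / 2) := by
  intro ω₂ lam β γ hω hl hβ hγ N hN Tm θ tstar hTm hθ hθm hts
  set P := pinnedChain ω₂ lam β γ with hP
  have hN0 : 0 < N := by omega
  have hθT : θ * Tm < 1 := (lt_div_iff₀ hTm).1 hθm
  -- the box constants
  set κ : ℝ := θ * (1 - θ * Tm) with hκ
  have hκ0 : 0 < κ := mul_pos hθ (by linarith only [hθT])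
  set Cst : ℝ := θ * γ * (Tm + Tm) with hCst
  have hCst0 : 0 ≤ Cst := by positivity
  -- the Hölder exponent: `1 < p`, `pθ < 1/T_m`
  set p : ℝ := (1 + 1 / (θ * Tm)) / 2 with hp
  have hθT0 : 0 < θ * Tm := by positivity
  have hp1 : 1 < p := by
    rw [hp]
    have : 1 < 1 / (θ * Tm) := by rw [lt_div_iff₀ hθT0]; linarith only [hθT]
    linarith only [this]
  have hpθ : p * θ < 1 / Tm := by
    rw [lt_div_iff₀ hTm, hp]
    have h1 : (1 + 1 / (θ * Tm)) / 2 * θ * Tm = (θ * Tm + 1) / 2 := by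
      field_simp
    calc (1 + 1 / (θ * Tm)) / 2 * θ * Tm = (θ * Tm + 1) / 2 := h1
      _ < 1 := by linarith only [hθT]
  have hpq := Real.HolderConjugate.conjExponent hp1
  set q := Real.conjExponent p with hq
  have hq0 : 0 < 1 / q := by have := hpq.symm.pos; positivity
  -- the deterministic inputs
  obtain ⟨Λ₀, ε₁, δ₀, a₀, hΛ₀, hε₁, hδ₀, ha₀, hF5⟩ := pinnedChain_dissipation_lower_bound hω hl hβ hγ.le hN0
  obtain ⟨m₀, a₁, hm₀, ha₁, hcell⟩ := pinnedChain_cell_energy_le hω hl.le hβ.le hγ.le N hΛ₀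
  set cmax : ℝ := Real.sqrt (2 * γ * Tm) with hcmax
  have hcmax0 : 0 ≤ cmax := Real.sqrt_nonneg _
  set m₁ : ℝ := m₀ / (cmax + 1) with hm₁
  have hm₁0 : 0 < m₁ := by positivity
  have hm₁le : cmax * m₁ ≤ m₀ := by
    rw [hm₁, mul_div_assoc']
    rw [div_le_iff₀ (by positivity)]
    nlinarith only [hcmax0, hm₀]
  -- the bound function and its decay
  set Bf : ℝ → ℝ := fun a => Real.exp (Cst * tstar) * Real.exp (-(κ * γ * ε₁ * tstar * a ^ 4)) +
      (tstar / Λ₀ * a + 1) * Real.exp (Cst * tstar) * Real.exp (-(θ / 2 * a ^ 4)) +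
      Real.exp (Cst * tstar) * ((tstar / Λ₀ * a + 1) * Real.exp (Cst * tstar) * Real.exp (-(θ / 2 * a ^ 4)) +
        (64 * Λ₀ * tstar / m₁ ^ 4) * (a ^ 5)⁻¹) ^ (1 / q) with hBf
  have hBf0 : Tendsto Bf atTop (𝓝 0) := by
    have h1 : Tendsto (fun a : ℝ => Real.exp (Cst * tstar) * Real.exp (-(κ * γ * ε₁ * tstar * a ^ 4))) atTop (𝓝 0) := by
      have := (tendsto_linear_mul_exp_neg_pow_four (c := 0) le_rfl (k := κ * γ * ε₁ * tstar) (by positivity)).const_mul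
        (Real.exp (Cst * tstar))
      simpa using this
    have h2 : Tendsto (fun a : ℝ => (tstar / Λ₀ * a + 1) * Real.exp (Cst * tstar) * Real.exp (-(θ / 2 * a ^ 4)))
        atTop (𝓝 0) := by
      have := (tendsto_linear_mul_exp_neg_pow_four (c := tstar / Λ₀) (by positivity) (k := θ / 2)
        (by positivity)).const_mul (Real.exp (Cst * tstar))
      rw [mul_zero] at this
      refine this.congr fun a => ?_
      ring
    have h3 : Tendsto (fun a : ℝ => (64 * Λ₀ * tstar / m₁ ^ 4) * (a ^ 5)⁻¹) atTop (𝓝 0) :=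
      tendsto_const_mul_inv_pow _ (by norm_num)
    have h4 := ((h2.add h3).rpow_const (Or.inr hq0.le)).const_mul (Real.exp (Cst * tstar))
    rw [add_zero, Real.zero_rpow hq0.ne', mul_zero] at h4
    have := (h1.add h2).add h4
    simpa only [add_zero] using this
  -- thresholds
  have hev : ∀ᶠ a : ℝ in atTop, Bf a < 1 / 2 ∧ max a₀ a₁ ≤ a ∧ 2 * Λ₀ / tstar ≤ a ∧ m₀ / δ₀ ≤ a ∧
      4 * Λ₀ / m₁ ^ 2 + 1 ≤ a ∧ 1 ≤ a := by
    refine ((tendsto_order.1 hBf0).2 _ (by norm_num)).and ((eventually_ge_atTop _).and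
      ((eventually_ge_atTop _).and ((eventually_ge_atTop _).and ((eventually_ge_atTop _).and (eventually_ge_atTop _)))))
  obtain ⟨A, hA⟩ := Filter.eventually_atTop.1 hev
  set A' : ℝ := max A 1 with hA'
  have hA'1 : 1 ≤ A' := le_max_right _ _
  refine ⟨A' ^ 4, fun T_L T_R hTL hTR hLm hRm x hx => ?_⟩
  ----------------------------------------------------------------
  -- Step 0: the true constants are dominated by the box constants
  ----------------------------------------------------------------
  have hTmax : 0 < max T_L T_R := lt_max_of_lt_left hTL
  have hmaxle : max T_L T_R ≤ Tm := max_le hLm hRm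
  have hinv : 1 / Tm ≤ 1 / max T_L T_R := one_div_le_one_div_of_le hTmax hmaxle
  have hθ' : θ < 1 / max T_L T_R := hθm.trans_le hinv
  have hpθ' : p * θ < 1 / max T_L T_R := hpθ.trans_le hinv
  have hκle : κ ≤ θ * (1 - θ * max T_L T_R) := by
    rw [hκ]
    refine mul_le_mul_of_nonneg_left ?_ hθ.le
    nlinarith only [hmaxle, hθ.le]
  have hCle : θ * γ * (T_L + T_R) ≤ Cst := by
    rw [hCst]
    exact mul_le_mul_of_nonneg_left (add_le_add hLm hRm) (by positivity)
  have hcmaxle : max (Real.sqrt (2 * γ * T_L)) (Real.sqrt (2 * γ * T_R)) ≤ cmax := by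
    rw [hcmax]
    exact max_le (Real.sqrt_le_sqrt (by nlinarith only [hLm, hγ.le]))
      (Real.sqrt_le_sqrt (by nlinarith only [hRm, hγ.le]))
  ----------------------------------------------------------------
  -- Step 1: the scale `a = H(x)^{1/4}` and the grid
  ----------------------------------------------------------------
  set E : ℝ := P.hamiltonian N x with hE
  have hE0 : 0 ≤ E := le_trans (by positivity) hx
  set a : ℝ := Real.sqrt (Real.sqrt E) with ha
  have ha_nonneg : 0 ≤ a := Real.sqrt_nonneg _
  have ha4 : a ^ 4 = E := by
    rw [ha, show (4 : ℕ) = 2 * 2 from rfl, pow_mul, Real.sq_sqrt (Real.sqrt_nonneg _), Real.sq_sqrt hE0]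
  have haA' : A' ≤ a := by
    have h1 : Real.sqrt (Real.sqrt (A' ^ 4)) = A' := by
      rw [show A' ^ 4 = (A' ^ 2) ^ 2 by ring, Real.sqrt_sq (by positivity), Real.sqrt_sq (by positivity)]
    rw [← h1, ha]
    exact Real.sqrt_le_sqrt (Real.sqrt_le_sqrt hx)
  obtain ⟨hBa, hmaxa, hΛa, hmδa, hΛm, ha1⟩ := hA a ((le_max_left _ _).trans haA')
  have ha0 : 0 < a := by linarith only [ha1]
  have haa₀ : a₀ ≤ a := (le_max_left _ _).trans hmaxa
  have haa₁ : a₁ ≤ a := (le_max_right _ _).trans hmaxa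
  -- the grid: `J = ⌊t* a / Λ₀⌋`, `τ = t*/J ∈ [Λ₀/a, 2Λ₀/a]`, `Jτ = t*`
  set r : ℝ := tstar * a / Λ₀ with hr
  have hr2 : 2 ≤ r := by
    rw [hr, le_div_iff₀ hΛ₀]
    have := (div_le_iff₀ hts).1 hΛa
    nlinarith only [this, hts.le]
  set J : ℕ := ⌊r⌋₊ with hJ
  have hJle : (J : ℝ) ≤ r := Nat.floor_le (by linarith only [hr2])
  have hJlt : r < J + 1 := Nat.lt_floor_add_one r
  have hJ1 : (1 : ℝ) ≤ J := by
    have : (1 : ℝ) < J := by linarith only [hr2, hJlt]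
    exact this.le
  have hJpos : (0 : ℝ) < J := by linarith only [hJ1]
  set τ : ℝ := tstar / J with hτ
  have hτ0 : 0 < τ := div_pos hts hJpos
  have hJτ : (J : ℝ) * τ = tstar := by rw [hτ]; field_simp
  have hτ1 : Λ₀ / a ≤ τ := by
    rw [hτ, div_le_div_iff₀ ha0 hJpos]
    have : (J : ℝ) * Λ₀ ≤ tstar * a := by
      have := hJle; rw [hr, le_div_iff₀ hΛ₀] at this; linarith only [this]
    linarith only [this]
  have hτ2 : τ ≤ 2 * Λ₀ / a := by
    rw [hτ, div_le_div_iff₀ hJpos ha0]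
    have : tstar * a ≤ 2 * Λ₀ * J := by
      have h2J : r ≤ 2 * J := by linarith only [hJlt, hJ1]
      rw [hr, div_le_iff₀ hΛ₀] at h2J; linarith only [h2J]
    linarith only [this]
  -- small-noise thresholds
  have hnoise2 : m₀ * a ≤ δ₀ * a ^ 2 := by
    have : m₀ ≤ δ₀ * a := by rw [div_le_iff₀ hδ₀] at hmδa; linarith only [hmδa]
    nlinarith only [this, ha0.le]
  have hm'0 : 0 ≤ m₁ * a := by positivity
  have hnoise : max (Real.sqrt (2 * γ * T_L)) (Real.sqrt (2 * γ * T_R)) * (m₁ * a) ≤ m₀ * a := by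
    calc max (Real.sqrt (2 * γ * T_L)) (Real.sqrt (2 * γ * T_R)) * (m₁ * a) ≤ cmax * (m₁ * a) :=
          mul_le_mul_of_nonneg_right hcmaxle hm'0
      _ = (cmax * m₁) * a := by ring
      _ ≤ m₀ * a := mul_le_mul_of_nonneg_right hm₁le ha0.le
  have hτsmall : τ ≤ (m₁ * a) ^ 2 / 2 := by
    refine hτ2.trans ?_
    rw [div_le_div_iff₀ ha0 (by norm_num : (0:ℝ) < 2)]
    have h3 : 4 * Λ₀ / m₁ ^ 2 < a := by linarith only [hΛm]
    rw [div_lt_iff₀ (by positivity)] at h3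
    have ha3 : a ≤ a ^ 3 := le_self_pow₀ ha1 (by norm_num)
    nlinarith only [h3, ha3, hΛ₀.le, hm₁0]
  ----------------------------------------------------------------
  -- Steps 2–5: the probabilistic core
  ----------------------------------------------------------------
  have hsum := uniformH2_core ω₂ lam β γ hω hl hβ hγ N hN T_L T_R hTL hTR θ hθ hθ' p hp1 hpθ' κ Cst hκ0 hκle hCle
    Λ₀ ε₁ δ₀ a₀ m₀ a₁ m₁ (fun a ha τ h1 h2 => hF5 ha h1 h2) (fun a ha τ h1 h2 => hcell ha h1 h2) tstar hts x a τ J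
    ha4 ha0 haa₀ haa₁ hτ0 hJτ hτ1 hτ2 hm'0 hnoise hnoise2 hτsmall
  rw [← hq] at hsum
  -- everything as one real number
  set g : ℝ := γ * ε₁ * tstar * E with hg
  set u₁ : ℝ := Real.exp (-(θ * (3 * E / 2))) * (Real.exp (Cst * tstar) * Real.exp (θ * E)) with hu₁
  set u₂ : ℝ := 2 * τ ^ 2 / ((m₁ * a) ^ 2 - τ) ^ 2 with hu₂
  have hu₁0 : 0 ≤ u₁ := by positivity
  have hu₂0 : 0 ≤ u₂ := by positivity
  set Y : ℝ := (J + 1) * u₁ + J * (2 * u₂) with hY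
  have hY0 : 0 ≤ Y := by positivity
  set X₁ : ℝ := Real.exp (-(κ * g)) * Real.exp (θ * E + Cst * tstar) with hX₁
  set X₂ : ℝ := Real.exp (Cst * tstar) * Real.exp (θ * E / 2) with hX₂
  set X₃ : ℝ := Real.exp (Cst * tstar) * Real.exp (θ * E) with hX₃
  have hX₁0 : 0 ≤ X₁ := by rw [hX₁]; positivity
  have hX₂0 : 0 ≤ X₂ := by rw [hX₂]; positivity
  have hX₃0 : 0 ≤ X₃ := by rw [hX₃]; positivity
  have hJ' : ENNReal.ofReal ((J : ℝ) + 1) = (J : ℝ≥0∞) + 1 := by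
    rw [ENNReal.ofReal_add (Nat.cast_nonneg J) zero_le_one, ENNReal.ofReal_natCast, ENNReal.ofReal_one]
  have hreal : ENNReal.ofReal (X₁ + (J + 1) * X₂ + X₃ * Y ^ (1 / q)) =
      ENNReal.ofReal X₁ + (J + 1) * ENNReal.ofReal X₂ + ENNReal.ofReal X₃ * ENNReal.ofReal Y ^ (1 / q) := by
    have h1 : 0 ≤ ((J : ℝ) + 1) * X₂ := by positivity
    have h2 : 0 ≤ X₃ * Y ^ (1 / q) := by positivity
    have h3 : 0 ≤ X₁ + ((J : ℝ) + 1) * X₂ := by positivity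
    rw [ENNReal.ofReal_add h3 h2, ENNReal.ofReal_add hX₁0 h1, ENNReal.ofReal_mul (by positivity : 0 ≤ (J : ℝ) + 1),
      ENNReal.ofReal_mul hX₃0, ENNReal.ofReal_rpow_of_nonneg hY0 hq0.le, hJ']
  ----------------------------------------------------------------
  -- Step 6: the real inequality `X₁ + (J+1)X₂ + X₃ Y^{1/q} ≤ e^{θE} Bf(a) ≤ e^{θE}/2`
  ----------------------------------------------------------------
  have hJr : (J : ℝ) ≤ tstar / Λ₀ * a := by rw [div_mul_eq_mul_div]; exact hJle
  have hEexp : Real.exp (θ * E) * Real.exp (-(θ / 2 * a ^ 4)) = Real.exp (θ * E / 2) := by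
    rw [← Real.exp_add, ha4]; congr 1; ring
  have hterm1 : X₁ = Real.exp (θ * E) * (Real.exp (Cst * tstar) * Real.exp (-(κ * γ * ε₁ * tstar * a ^ 4))) := by
    rw [hX₁, hg, ← ha4, Real.exp_add]
    have : -(κ * (γ * ε₁ * tstar * a ^ 4)) = -(κ * γ * ε₁ * tstar * a ^ 4) := by ring
    rw [this]; ring
  have hterm2 : (J + 1) * X₂ ≤ Real.exp (θ * E) * ((tstar / Λ₀ * a + 1) * Real.exp (Cst * tstar) *
      Real.exp (-(θ / 2 * a ^ 4))) := by
    rw [hX₂, ← hEexp]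
    have h0 : 0 ≤ Real.exp (Cst * tstar) * (Real.exp (θ * E) * Real.exp (-(θ / 2 * a ^ 4))) := by positivity
    calc ((J : ℝ) + 1) * (Real.exp (Cst * tstar) * (Real.exp (θ * E) * Real.exp (-(θ / 2 * a ^ 4))))
        ≤ (tstar / Λ₀ * a + 1) * (Real.exp (Cst * tstar) * (Real.exp (θ * E) * Real.exp (-(θ / 2 * a ^ 4)))) :=
          mul_le_mul_of_nonneg_right (by linarith only [hJr]) h0
      _ = _ := by ring
  have hu₂_le : u₂ ≤ 32 * Λ₀ ^ 2 / (m₁ ^ 4 * a ^ 6) := by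
    rw [hu₂]
    have hden : (m₁ * a) ^ 2 / 2 ≤ (m₁ * a) ^ 2 - τ := by linarith only [hτsmall]
    have hden0 : 0 < (m₁ * a) ^ 2 / 2 := by positivity
    have h1 : 2 * τ ^ 2 / ((m₁ * a) ^ 2 - τ) ^ 2 ≤ 2 * τ ^ 2 / ((m₁ * a) ^ 2 / 2) ^ 2 := by
      refine div_le_div_of_nonneg_left (by positivity) (by positivity) ?_
      exact pow_le_pow_left₀ hden0.le hden 2
    refine h1.trans ?_
    have hτ2' : τ ^ 2 ≤ (2 * Λ₀ / a) ^ 2 := pow_le_pow_left₀ hτ0.le hτ2 2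
    rw [div_le_div_iff₀ (by positivity) (by positivity)]
    have : 2 * τ ^ 2 * (m₁ ^ 4 * a ^ 6) ≤ 2 * (2 * Λ₀ / a) ^ 2 * (m₁ ^ 4 * a ^ 6) :=
      mul_le_mul_of_nonneg_right (by linarith only [hτ2']) (by positivity)
    refine this.trans (le_of_eq ?_)
    field_simp
    ring
  have hY_le : Y ≤ (tstar / Λ₀ * a + 1) * Real.exp (Cst * tstar) * Real.exp (-(θ / 2 * a ^ 4)) +
      (64 * Λ₀ * tstar / m₁ ^ 4) * (a ^ 5)⁻¹ := by
    rw [hY]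
    refine add_le_add ?_ ?_
    · rw [hu₁]
      have he : Real.exp (-(θ * (3 * E / 2))) * (Real.exp (Cst * tstar) * Real.exp (θ * E)) =
          Real.exp (Cst * tstar) * Real.exp (-(θ / 2 * a ^ 4)) := by
        rw [← ha4, mul_comm, mul_assoc, ← Real.exp_add]; congr 1; ring_nf
      rw [he]
      have h0 : 0 ≤ Real.exp (Cst * tstar) * Real.exp (-(θ / 2 * a ^ 4)) := by positivity
      calc ((J : ℝ) + 1) * (Real.exp (Cst * tstar) * Real.exp (-(θ / 2 * a ^ 4)))
          ≤ (tstar / Λ₀ * a + 1) * (Real.exp (Cst * tstar) * Real.exp (-(θ / 2 * a ^ 4))) :=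
            mul_le_mul_of_nonneg_right (by linarith only [hJr]) h0
        _ = _ := by ring
    · calc (J : ℝ) * (2 * u₂) ≤ (tstar / Λ₀ * a) * (2 * (32 * Λ₀ ^ 2 / (m₁ ^ 4 * a ^ 6))) :=
            mul_le_mul hJr (by linarith only [hu₂_le]) (by positivity) (by positivity)
        _ = (64 * Λ₀ * tstar / m₁ ^ 4) * (a ^ 5)⁻¹ := by field_simp; ring
  have hterm3 : X₃ * Y ^ (1 / q) ≤ Real.exp (θ * E) * (Real.exp (Cst * tstar) *
      ((tstar / Λ₀ * a + 1) * Real.exp (Cst * tstar) * Real.exp (-(θ / 2 * a ^ 4)) +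
        (64 * Λ₀ * tstar / m₁ ^ 4) * (a ^ 5)⁻¹) ^ (1 / q)) := by
    rw [hX₃]
    have hrp := Real.rpow_le_rpow hY0 hY_le hq0.le
    calc Real.exp (Cst * tstar) * Real.exp (θ * E) * Y ^ (1 / q)
        ≤ Real.exp (Cst * tstar) * Real.exp (θ * E) * ((tstar / Λ₀ * a + 1) * Real.exp (Cst * tstar) *
            Real.exp (-(θ / 2 * a ^ 4)) + (64 * Λ₀ * tstar / m₁ ^ 4) * (a ^ 5)⁻¹) ^ (1 / q) :=
          mul_le_mul_of_nonneg_left hrp (by positivity)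
      _ = _ := by ring
  have hfinal : X₁ + (J + 1) * X₂ + X₃ * Y ^ (1 / q) ≤ Real.exp (θ * E) * Bf a := by
    rw [hterm1, hBf]
    simp only
    nlinarith only [hterm2, hterm3, Real.exp_pos (θ * E)]
  have hhalf : Real.exp (θ * E) * Bf a ≤ Real.exp (θ * E) / 2 := by
    have := hBa.le
    nlinarith only [this, Real.exp_pos (θ * E)]
  calc ∫⁻ ω, ENNReal.ofReal (Real.exp (θ * P.hamiltonian N (P.solMap N T_L T_R tstar x (pairPath ω)))) ∂wienerPair
      ≤ _ := hsum
    _ = ENNReal.ofReal (X₁ + (J + 1) * X₂ + X₃ * Y ^ (1 / q)) := hreal.symm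
    _ ≤ ENNReal.ofReal (Real.exp (θ * E) / 2) := ENNReal.ofReal_le_ofReal (hfinal.trans hhalf)

end Summit.AtomisticToContinuum.FouriersLaw.Theorems.LinearResponseFTUR

end
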